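import Mathlib
import Summits.QuantumAdvantage.QuantumAdvantage.Theorems.MobiusLadderQuadraticDigitPhasesStubOrbitCancel

/-!
# Tame core campaign, file 3: quadratic phase algebra and tame index lemmas (toward `stub_tameCore`)

Helper file of the campaign proving the registered stubs `stub_tameCore` / `stub_cellTame` of the crux
`MobiusLadder.QuadraticDigitPhases` (stmt-QuantumAdvantage-1391), line `Sketch`.  Mathlib only; pure algebra
over `ZMod 2` (the expansion over any commutative ring) and bookkeeping of indices.

* `expansion`: FIRST-ORDER EXPANSION of the quadratic phase
  `Φ[Y] = Σ_{i<j<N} a i j Yᵢ Yⱼ + Σ_{i<N} lᵢ Yᵢ` under a change `D`: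
  `Φ[Y + D] = Φ[Y] + Σ_i (Σ_j Aˢʸᵐ i j Dⱼ) Yᵢ + Φ[D]` with the symmetrised coefficients
  `Aˢʸᵐ i j = a_{min,max}` (`i ≠ j`), `0` on the diagonal.
* TAME INDEX LEMMAS for a change vector `Δ` supported on a window `[b, b+L]` with `Δ_b = 1` ("source" `b`,
  "junk" `(b, b+L]`), under TAMENESS (a junk position interacts only within distance `s`) and SEPARATION of
  the sources (`> L + s`): the coefficient `Σ_j Aˢʸᵐ i j Δⱼ` splits as `Aˢʸᵐ i b + (junk part)`
  (`coef_split`), the junk part vanishes far above the window (`coef_junk_far`), the CROSS TERM of two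
  distinct sources is the single entry `Aˢʸᵐ b' b` (`cross_sum`, so the `p`- and `q`-registers cancel), an
  INERT window (no interactions, no linear terms on the junk) has coefficients `Aˢʸᵐ i b` and self-phase
  `l b` (`coef_inert`, `phase_inert`), and beyond the level `N` only the source row survives
  (`label_sum`, from the strong tameness "junk interacts only below `N`").
* `sum_range_pivot`, `sum_swap_coef`: splitting a sum at a pivot and exchanging the member sum with the
  position sum.
* `orbit_assembly`: the FIBREWISE ORBIT CANCELLATION in the form both registered stubs consume — for flips
  preserving a good set and a state map, flip-invariant signs `ρ_j = ±1` with `ε ∘ σ_j = ρ_j ε`, the sum over the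
  states of `|Σ_{fibre} ε|` is at most `#Bad + #{good, all ρ_j = 1}` (`…StubOrbitCancel.sum_filter_not_forall_eq_zero`
  fibre by fibre).
-/

set_option linter.dupNamespace false -- D-0017: single-problem summit ⇒ `QuantumAdvantage.QuantumAdvantage` by design

namespace Summit.QuantumAdvantage.QuantumAdvantage.Theorems.MobiusLadderQuadraticDigitPhasesStubTameCorePhase

open Finset
open Summit.QuantumAdvantage.QuantumAdvantage.Theorems.MobiusLadderQuadraticDigitPhasesStubOrbitCancel
  (sum_filter_not_forall_eq_zero)

/-! ## The first-order expansion -/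

/-- The symmetrised coefficient is the sum of the strictly upper triangular coefficient and its transpose. -/
theorem asym_eq_add {R : Type*} [CommRing R] (a : ℕ → ℕ → R) (i j : ℕ) :
    (if i < j then a i j else if j < i then a j i else 0) =
      (if i < j then a i j else 0) + (if j < i then a j i else 0) := by
  by_cases h1 : i < j
  · rw [if_pos h1, if_pos h1, if_neg (lt_asymm h1), add_zero]
  · rw [if_neg h1, if_neg h1, zero_add]

/-- The symmetrised coefficient is symmetric. -/
theorem asym_symm {R : Type*} [CommRing R] (a : ℕ → ℕ → R) (i j : ℕ) :
    (if i < j then a i j else if j < i then a j i else 0) =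
      (if j < i then a j i else if i < j then a i j else 0) := by
  by_cases h1 : i < j
  · rw [if_pos h1, if_neg (lt_asymm h1), if_pos h1]
  · by_cases h2 : j < i
    · rw [if_neg h1, if_pos h2, if_pos h2]
    · rw [if_neg h1, if_neg h2, if_neg h2, if_neg h1]

/-- FIRST-ORDER EXPANSION of the quadratic phase `Φ[Y] = Σ_{i<j<N} a i j Yᵢ Yⱼ + Σ_{i<N} lᵢ Yᵢ` under a
change `D`: `Φ[Y + D] = Φ[Y] + Σ_i (Σ_j Aˢʸᵐ i j Dⱼ) Yᵢ + Φ[D]` (any commutative ring). [folklore] -/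
theorem expansion {R : Type*} [CommRing R] (N : ℕ) (a : ℕ → ℕ → R) (l Y D : ℕ → R) :
    (∑ i ∈ range N, ∑ j ∈ range N, (if i < j then a i j * (Y i + D i) * (Y j + D j) else 0) +
        ∑ i ∈ range N, l i * (Y i + D i)) =
      (∑ i ∈ range N, ∑ j ∈ range N, (if i < j then a i j * Y i * Y j else 0) + ∑ i ∈ range N, l i * Y i) +
        ∑ i ∈ range N, (∑ j ∈ range N, (if i < j then a i j else if j < i then a j i else 0) * D j) * Y i +
        (∑ i ∈ range N, ∑ j ∈ range N, (if i < j then a i j * D i * D j else 0) +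
          ∑ i ∈ range N, l i * D i) := by
  have h1 : ∀ i j, (if i < j then a i j * (Y i + D i) * (Y j + D j) else 0) =
      (if i < j then a i j * Y i * Y j else 0) +
        ((if i < j then a i j else 0) * D j * Y i + (if i < j then a i j else 0) * D i * Y j) +
        (if i < j then a i j * D i * D j else 0) := by
    intro i j
    split_ifs <;> ring
  have h2 : ∀ i, l i * (Y i + D i) = l i * Y i + l i * D i := fun i => by ring
  have hmid : (∑ i ∈ range N, ∑ j ∈ range N, (if i < j then a i j else 0) * D j * Y i +
      ∑ i ∈ range N, ∑ j ∈ range N, (if i < j then a i j else 0) * D i * Y j) =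
      ∑ i ∈ range N, (∑ j ∈ range N, (if i < j then a i j else if j < i then a j i else 0) * D j) * Y i := by
    rw [Finset.sum_comm (f := fun i j => (if i < j then a i j else 0) * D i * Y j), ← sum_add_distrib]
    refine sum_congr rfl fun i _ => ?_
    rw [← sum_add_distrib, sum_mul]
    refine sum_congr rfl fun j _ => ?_
    rw [asym_eq_add]
    ring
  simp only [h1, h2, sum_add_distrib]
  rw [← hmid]
  abel

/-! ## Tame index lemmas for a window-supported change vector -/

/-- A nonzero symmetrised coefficient comes from a nonzero entry. -/
theorem ne_zero_of_asym_ne_zero {R : Type*} [CommRing R] (a : ℕ → ℕ → R) (i j : ℕ)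
    (h : (if i < j then a i j else if j < i then a j i else 0) ≠ 0) : a i j ≠ 0 ∨ a j i ≠ 0 := by
  by_cases h1 : i < j
  · rw [if_pos h1] at h; exact Or.inl h
  · by_cases h2 : j < i
    · rw [if_neg h1, if_pos h2] at h; exact Or.inr h
    · rw [if_neg h1, if_neg h2] at h; exact absurd rfl h

/-- TAMENESS kills the symmetrised coefficients between a junk position `j ∈ (b, b+L]` of a source `b ∈ B`
and any position `i < N` at distance `> s`. -/
theorem asym_junk_eq_zero (a : ℕ → ℕ → ZMod 2) (B : Finset ℕ) (L s N : ℕ)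
    (hT : ∀ b ∈ B, ∀ j, b < j → j ≤ b + L → ∀ i, i < N → (a i j ≠ 0 ∨ a j i ≠ 0) → Nat.dist i j ≤ s)
    {b : ℕ} (hb : b ∈ B) {j : ℕ} (hbj : b < j) (hjL : j ≤ b + L) {i : ℕ} (hi : i < N)
    (hdist : s < Nat.dist i j) :
    (if i < j then a i j else if j < i then a j i else 0) = 0 ∧
      (if j < i then a j i else if i < j then a i j else 0) = 0 := by
  have h1 : (if i < j then a i j else if j < i then a j i else 0) = 0 := by
    by_contra hne
    exact absurd (hT b hb j hbj hjL i hi (ne_zero_of_asym_ne_zero a i j hne)) (not_le.mpr hdist)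
  exact ⟨h1, by rw [← asym_symm a i j]; exact h1⟩

/-- SPLITTING A COEFFICIENT: for a change vector `Δ` supported on `[b, b+L]` with `Δ_b = 1` (`b < N`), the
coefficient `Σ_{j<N} Aˢʸᵐ i j Δⱼ` is the source entry `Aˢʸᵐ i b` plus the junk part. -/
theorem coef_split (a : ℕ → ℕ → ZMod 2) (N b L : ℕ) (Δ : ℕ → ZMod 2) (hbN : b < N) (hΔb : Δ b = 1)
    (hsupp : ∀ j, Δ j ≠ 0 → b ≤ j ∧ j ≤ b + L) (i : ℕ) :
    ∑ j ∈ range N, (if i < j then a i j else if j < i then a j i else 0) * Δ j =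
      (if i < b then a i b else if b < i then a b i else 0) +
        ∑ j ∈ range N, (if b < j ∧ j ≤ b + L then
          (if i < j then a i j else if j < i then a j i else 0) * Δ j else 0) := by
  have hpt : ∀ j, (if i < j then a i j else if j < i then a j i else 0) * Δ j =
      (if j = b then (if i < b then a i b else if b < i then a b i else 0) else 0) +
        (if b < j ∧ j ≤ b + L then (if i < j then a i j else if j < i then a j i else 0) * Δ j else 0) := by
    intro j
    by_cases hjb : j = b
    · subst hjb
      rw [if_pos rfl, if_neg (show ¬ (j < j ∧ j ≤ j + L) from fun h => lt_irrefl _ h.1), hΔb, mul_one,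
        add_zero]
    rw [if_neg hjb, zero_add]
    by_cases hj : b < j ∧ j ≤ b + L
    · rw [if_pos hj]
    · rw [if_neg hj]
      have : Δ j = 0 := by
        by_contra hne
        have := hsupp j hne
        exact hj ⟨by omega, this.2⟩
      rw [this, mul_zero]
  rw [sum_congr rfl fun j _ => hpt j, sum_add_distrib, sum_ite_eq' (range N) b, if_pos (mem_range.mpr hbN)]

/-- The JUNK PART of a coefficient VANISHES at every position `i < N` that is more than `s` away from the
whole junk window `(b, b+L]` — in particular for `i > b + L + s`. -/
theorem coef_junk_far (a : ℕ → ℕ → ZMod 2) (B : Finset ℕ) (L s N : ℕ)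
    (hT : ∀ b ∈ B, ∀ j, b < j → j ≤ b + L → ∀ i, i < N → (a i j ≠ 0 ∨ a j i ≠ 0) → Nat.dist i j ≤ s)
    {b : ℕ} (hb : b ∈ B) (Δ : ℕ → ZMod 2) (i : ℕ) (hi : i < N)
    (hfar : ∀ j, b < j → j ≤ b + L → s < Nat.dist i j) :
    ∑ j ∈ range N, (if b < j ∧ j ≤ b + L then
      (if i < j then a i j else if j < i then a j i else 0) * Δ j else 0) = 0 := by
  refine sum_eq_zero fun j _ => ?_
  by_cases h : b < j ∧ j ≤ b + L
  · rw [if_pos h, (asym_junk_eq_zero a B L s N hT hb h.1 h.2 hi (hfar j h.1 h.2)).1, zero_mul]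
  · rw [if_neg h]

/-- THE CROSS TERM of two distinct separated sources `b ≠ b'` of `B`: for change vectors `Δ` (at `b`) and
`Δ'` (at `b'`) supported on their windows with `Δ_b = Δ'_{b'} = 1`, the bilinear cross term
`Σ_i Σ_j Aˢʸᵐ i j Δⱼ Δ'ᵢ` is the single source–source entry `Aˢʸᵐ b' b` (the `p`- and `q`-register copies of
which cancel in characteristic two). -/
theorem cross_sum (a : ℕ → ℕ → ZMod 2) (B : Finset ℕ) (L s N : ℕ)
    (hT : ∀ b ∈ B, ∀ j, b < j → j ≤ b + L → ∀ i, i < N → (a i j ≠ 0 ∨ a j i ≠ 0) → Nat.dist i j ≤ s)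
    (hsep : ∀ b ∈ B, ∀ b' ∈ B, b < b' → L + s < b' - b)
    {b b' : ℕ} (hb : b ∈ B) (hb' : b' ∈ B) (hne : b ≠ b') (hbN : b < N) (hb'N : b' < N)
    (Δ Δ' : ℕ → ZMod 2) (hΔb : Δ b = 1) (hsupp : ∀ j, Δ j ≠ 0 → b ≤ j ∧ j ≤ b + L)
    (hΔ'b : Δ' b' = 1) (hsupp' : ∀ j, Δ' j ≠ 0 → b' ≤ j ∧ j ≤ b' + L) :
    ∑ i ∈ range N, (∑ j ∈ range N, (if i < j then a i j else if j < i then a j i else 0) * Δ j) * Δ' i =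
      (if b' < b then a b' b else if b < b' then a b b' else 0) := by
  have hgap : L + s < Nat.dist b b' := by
    rcases lt_or_gt_of_ne hne with h | h
    · have := hsep b hb b' hb' h; simp only [Nat.dist]; omega
    · have := hsep b' hb' b hb h; simp only [Nat.dist]; omega
  rw [sum_eq_single_of_mem b' (mem_range.mpr hb'N)]
  · rw [hΔ'b, mul_one, sum_eq_single_of_mem b (mem_range.mpr hbN)]
    · rw [hΔb, mul_one]
    · intro j hj hjb
      by_cases hz : Δ j = 0
      · rw [hz, mul_zero]
      · have hs := hsupp j hz
        have hbj : b < j := lt_of_le_of_ne hs.1 (Ne.symm hjb)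
        rw [(asym_junk_eq_zero a B L s N hT hb hbj hs.2 hb'N
          (by simp only [Nat.dist] at hgap ⊢; omega)).1, zero_mul]
  · intro i hi hib
    by_cases hz : Δ' i = 0
    · rw [hz, mul_zero]
    · have hs := hsupp' i hz
      have hbi : b' < i := lt_of_le_of_ne hs.1 (Ne.symm hib)
      rw [sum_eq_zero, zero_mul]
      intro j hj
      by_cases hzj : Δ j = 0
      · rw [hzj, mul_zero]
      · have hsj := hsupp j hzj
        rw [(asym_junk_eq_zero a B L s N hT hb' hbi hs.2 (mem_range.mp hj)
          (by simp only [Nat.dist] at hgap ⊢; omega)).2, zero_mul]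

/-- INERT WINDOW, coefficients: if the junk of `b` has no interactions below `N`, the coefficient at every
`i < N` is the bare source entry `Aˢʸᵐ i b`. -/
theorem coef_inert (a : ℕ → ℕ → ZMod 2) (N b L : ℕ) (Δ : ℕ → ZMod 2) (hbN : b < N) (hΔb : Δ b = 1)
    (hsupp : ∀ j, Δ j ≠ 0 → b ≤ j ∧ j ≤ b + L)
    (hin : ∀ j, b < j → j ≤ b + L → ∀ i', i' < N → a i' j = 0 ∧ a j i' = 0) (i : ℕ) (hi : i < N) :
    ∑ j ∈ range N, (if i < j then a i j else if j < i then a j i else 0) * Δ j =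
      (if i < b then a i b else if b < i then a b i else 0) := by
  rw [coef_split a N b L Δ hbN hΔb hsupp i, sum_eq_zero, add_zero]
  intro j _
  by_cases h : b < j ∧ j ≤ b + L
  · rw [if_pos h]
    have hz := hin j h.1 h.2 i hi
    by_cases h1 : i < j
    · rw [if_pos h1, hz.1, zero_mul]
    by_cases h2 : j < i
    · rw [if_neg h1, if_pos h2, hz.2, zero_mul]
    · rw [if_neg h1, if_neg h2, zero_mul]
  · rw [if_neg h]

/-- INERT WINDOW, self-phase: if the junk of `b` has no interactions below `N` and carries no linear terms,
`Φ[Δ] = l b`. -/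
theorem phase_inert (a : ℕ → ℕ → ZMod 2) (l : ℕ → ZMod 2) (N b L : ℕ) (Δ : ℕ → ZMod 2) (hbN : b < N)
    (hΔb : Δ b = 1) (hsupp : ∀ j, Δ j ≠ 0 → b ≤ j ∧ j ≤ b + L)
    (hin : ∀ j, b < j → j ≤ b + L → l j = 0 ∧ ∀ i', i' < N → a i' j = 0 ∧ a j i' = 0) :
    (∑ i ∈ range N, ∑ j ∈ range N, (if i < j then a i j * Δ i * Δ j else 0) + ∑ i ∈ range N, l i * Δ i) =
      l b := by
  rw [sum_eq_zero, zero_add, sum_eq_single_of_mem b (mem_range.mpr hbN), hΔb, mul_one]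
  · intro i _ hib
    by_cases hz : Δ i = 0
    · rw [hz, mul_zero]
    · have hs := hsupp i hz
      rw [(hin i (lt_of_le_of_ne hs.1 (Ne.symm hib)) hs.2).1, zero_mul]
  · intro i hi
    refine sum_eq_zero fun j _ => ?_
    by_cases hij : i < j
    · rw [if_pos hij]
      by_cases hzi : Δ i = 0
      · rw [hzi, mul_zero, zero_mul]
      by_cases hzj : Δ j = 0
      · rw [hzj, mul_zero]
      have hsi := hsupp i hzi
      have hsj := hsupp j hzj
      rw [((hin j (by omega) hsj.2).2 i (mem_range.mp hi)).1, zero_mul, zero_mul]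
    · rw [if_neg hij]

/-- BEYOND THE LEVEL `N` only the source row survives: under the strong tameness (junk interacts only with
positions below `N`), `Σ_{i<N} a i j Δᵢ = a b j` for every column `N ≤ j < n`. -/
theorem label_sum (a : ℕ → ℕ → ZMod 2) (B : Finset ℕ) (L s N n : ℕ)
    (hT : ∀ b ∈ B, ∀ j, b < j → j ≤ b + L → ∀ i, i < n → (a i j ≠ 0 ∨ a j i ≠ 0) → (Nat.dist i j ≤ s ∧ i < N))
    {b : ℕ} (hb : b ∈ B) (hbN : b < N) (Δ : ℕ → ZMod 2) (hΔb : Δ b = 1)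
    (hsupp : ∀ j, Δ j ≠ 0 → b ≤ j ∧ j ≤ b + L) (j : ℕ) (hNj : N ≤ j) (hjn : j < n) :
    ∑ i ∈ range N, a i j * Δ i = a b j := by
  rw [sum_eq_single_of_mem b (mem_range.mpr hbN), hΔb, mul_one]
  intro i _ hib
  by_cases hz : Δ i = 0
  · rw [hz, mul_zero]
  · have hs := hsupp i hz
    have hbi : b < i := lt_of_le_of_ne hs.1 (Ne.symm hib)
    have ha : a i j = 0 := by
      by_contra hne
      exact absurd (hT b hb i hbi hs.2 j hjn (Or.inr hne)).2 (not_lt.mpr hNj)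
    rw [ha, zero_mul]

/-! ## Sum bookkeeping -/

/-- Splitting a sum over `range N` at a pivot `m` (`1 ≤ m < N`) when the terms below `m - 1` vanish. -/
theorem sum_range_pivot {M : Type*} [AddCommMonoid M] (g : ℕ → M) (m N : ℕ) (h1m : 1 ≤ m) (hmN : m < N)
    (hlow : ∀ i, i < m - 1 → g i = 0) :
    ∑ i ∈ range N, g i = g (m - 1) + g m + ∑ i ∈ (range N).filter (fun i => m < i), g i := by
  obtain ⟨t, rfl⟩ : ∃ t, m = t + 1 := ⟨m - 1, by omega⟩
  simp only [Nat.add_sub_cancel] at hlow ⊢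
  have hf : (range N).filter (fun i => t + 1 < i) = Ico (t + 2) N := by
    ext i; simp only [mem_filter, mem_range, mem_Ico]; omega
  have hmid : ∑ k ∈ Ico t (t + 2), g k = g t + g (t + 1) := by
    rw [sum_Ico_succ_top (by omega : t ≤ t + 1), Nat.Ico_succ_singleton, sum_singleton]
  rw [hf, range_eq_Ico, ← sum_Ico_consecutive g (Nat.zero_le t) (by omega : t ≤ N),
    ← sum_Ico_consecutive g (by omega : t ≤ t + 2) (by omega : t + 2 ≤ N),
    sum_eq_zero (fun i hi => hlow i (mem_Ico.mp hi).2), zero_add, hmid]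

/-- Exchanging the member sum with the position sum and collecting the symmetrised source entries:
`Σ_{b∈u} Σ_{i∈S} Aˢʸᵐ i b · eᵢ = Σ_{i∈S} (Σ_{b∈u} Aˢʸᵐ b i) · eᵢ`. -/
theorem sum_swap_coef (a : ℕ → ℕ → ZMod 2) (u S : Finset ℕ) (e : ℕ → ZMod 2) :
    ∑ b ∈ u, ∑ i ∈ S, (if i < b then a i b else if b < i then a b i else 0) * e i =
      ∑ i ∈ S, (∑ b ∈ u, (if b < i then a b i else if i < b then a i b else 0)) * e i := by
  rw [Finset.sum_comm]
  refine sum_congr rfl fun i _ => ?_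
  rw [sum_mul]
  refine sum_congr rfl fun b _ => ?_
  rw [asym_symm]

/-! ## Fibrewise orbit cancellation -/

/-- Sums of fibre cardinalities over distinct states are bounded by the cardinality of the whole set. -/
theorem sum_card_fiber_le {κ : Type*} [DecidableEq κ] (X : Finset ℕ) (S : Finset κ) (st : ℕ → κ) :
    ∑ E ∈ S, (X.filter (fun T => st T = E)).card ≤ X.card := by
  rw [sum_card_fiberwise_eq_card_filter]
  exact card_filter_le _ _

/-- A sum of terms of absolute value at most one is bounded by the number of terms. -/
theorem abs_sum_le_card (X : Finset ℕ) (ε : ℕ → ℝ) (hε : ∀ T, |ε T| ≤ 1) :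
    |∑ T ∈ X, ε T| ≤ (X.card : ℝ) := by
  refine le_trans (abs_sum_le_sum_abs _ _) ?_
  calc ∑ T ∈ X, |ε T| ≤ ∑ T ∈ X, (1 : ℝ) := sum_le_sum fun T _ => hε T
    _ = X.card := by rw [sum_const, nsmul_eq_mul, mul_one]

/-- FIBREWISE ORBIT CANCELLATION.  On a finite set `Ω` of inputs with a good part `Good`, let flips `σ_j`
preserve `Ω ∩ Good` and a state map `st`, be involutive there, and act on a phase `ε` (`|ε| ≤ 1`) through
flip-invariant signs `ρ_j = ±1`: `ε (σ_j T) = ρ_j T · ε T`.  Then the state-by-state cancellation is at least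
`Σ_{E} |Σ_{T ∈ Ω, st T = E} ε T| ≤ #(Ω ∖ Good) + #{T ∈ Ω ∩ Good : ρ_j T = 1 ∀ j}`. -/
theorem orbit_assembly {κ : Type*} [DecidableEq κ] {d : ℕ} (Ω : Finset ℕ) (Good : ℕ → Prop)
    [DecidablePred Good] (st : ℕ → κ) (S : Finset κ) (σ : Fin d → ℕ → ℕ) (ρ : Fin d → ℕ → ℝ) (ε : ℕ → ℝ)
    (hε : ∀ T, |ε T| ≤ 1) (hΩ : ∀ j, ∀ T ∈ Ω, Good T → σ j T ∈ Ω)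
    (hG : ∀ j, ∀ T ∈ Ω, Good T → Good (σ j T)) (hst : ∀ j, ∀ T ∈ Ω, Good T → st (σ j T) = st T)
    (hinv : ∀ j, ∀ T ∈ Ω, Good T → σ j (σ j T) = T)
    (hρ : ∀ j, ∀ T ∈ Ω, Good T → ρ j T = 1 ∨ ρ j T = -1)
    (hρinv : ∀ i j, ∀ T ∈ Ω, Good T → ρ i (σ j T) = ρ i T)
    (hεσ : ∀ j, ∀ T ∈ Ω, Good T → ε (σ j T) = ρ j T * ε T) :
    ∑ E ∈ S, |∑ T ∈ Ω.filter (fun T => st T = E), ε T| ≤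
      ((Ω.filter (fun T => ¬ Good T)).card : ℝ) +
        ((Ω.filter (fun T => Good T ∧ ∀ j, ρ j T = 1)).card : ℝ) := by
  have key : ∀ E ∈ S, |∑ T ∈ Ω.filter (fun T => st T = E), ε T| ≤
      (((Ω.filter (fun T => ¬ Good T)).filter (fun T => st T = E)).card : ℝ) +
        (((Ω.filter (fun T => Good T ∧ ∀ j, ρ j T = 1)).filter (fun T => st T = E)).card : ℝ) := by
    intro E _
    set GE := (Ω.filter (fun T => st T = E)).filter Good with hGE
    have hmemGE : ∀ T, T ∈ GE ↔ T ∈ Ω ∧ st T = E ∧ Good T := fun T => by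
      rw [hGE, mem_filter, mem_filter, and_assoc]
    have hcancel := sum_filter_not_forall_eq_zero σ ρ GE ε
      (fun j T hT => by
        obtain ⟨h1, h2, h3⟩ := (hmemGE T).mp hT
        exact (hmemGE _).mpr ⟨hΩ j T h1 h3, by rw [hst j T h1 h3, h2], hG j T h1 h3⟩)
      (fun j T hT => by
        obtain ⟨h1, -, h3⟩ := (hmemGE T).mp hT
        exact hinv j T h1 h3)
      (fun j T hT => by
        obtain ⟨h1, -, h3⟩ := (hmemGE T).mp hT
        exact hρ j T h1 h3)
      (fun i j T hT => by
        obtain ⟨h1, -, h3⟩ := (hmemGE T).mp hT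
        exact hρinv i j T h1 h3)
      (fun j T hT => by
        obtain ⟨h1, -, h3⟩ := (hmemGE T).mp hT
        exact hεσ j T h1 h3)
    rw [← sum_filter_add_sum_filter_not (Ω.filter (fun T => st T = E)) Good,
      ← sum_filter_add_sum_filter_not GE (fun T => ∀ j, ρ j T = 1), hcancel, add_zero]
    refine le_trans (abs_add_le _ _) ?_
    rw [add_comm]
    refine add_le_add ?_ ?_
    · refine le_trans (abs_sum_le_card _ ε hε) (le_of_eq ?_)
      congr 2
      rw [filter_filter, filter_filter]
      exact filter_congr fun T _ => by tauto
    · refine le_trans (abs_sum_le_card _ ε hε) (le_of_eq ?_)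
      congr 2
      rw [hGE, filter_filter, filter_filter, filter_filter]
      exact filter_congr fun T _ => by tauto
  refine le_trans (sum_le_sum key) ?_
  rw [sum_add_distrib]
  refine add_le_add ?_ ?_
  · exact_mod_cast sum_card_fiber_le _ S st
  · exact_mod_cast sum_card_fiber_le _ S st

/-- MAIN STATEMENT of this helper file (registered campaign stub toward `stub_tameCore`): the first-order expansion of
the quadratic digit phase over `ZMod 2`. -/
theorem stub_tameCorePhase : ∀ (N : ℕ) (a : ℕ → ℕ → ZMod 2) (l Y D : ℕ → ZMod 2), (∑ i ∈ Finset.range N, ∑ j ∈ Finset.range N, (if i < j then a i j * (Y i + D i) * (Y j + D j) else 0) + ∑ i ∈ Finset.range N, l i * (Y i + D i)) = (∑ i ∈ Finset.range N, ∑ j ∈ Finset.range N, (if i < j then a i j * Y i * Y j else 0) + ∑ i ∈ Finset.range N, l i * Y i) + ∑ i ∈ Finset.range N, (∑ j ∈ Finset.range N, (if i < j then a i j else if j < i then a j i else 0) * D j) * Y i + (∑ i ∈ Finset.range N, ∑ j ∈ Finset.range N, (if i < j then a i j * D i * D j else 0) + ∑ i ∈ Finset.range N, l i * D i) := by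
  intro N a l Y D
  exact expansion N a l Y D

end Summit.QuantumAdvantage.QuantumAdvantage.Theorems.MobiusLadderQuadraticDigitPhasesStubTameCorePhase
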